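import Literature.Barriers.RiemannHypothesis.TuranPartialSumsShiftMain
import HarnessLib

/-!
# Sections of `ζ` beyond `σ = 1`: pointwise enclosures and quadrature facts for the checker

Barrier catalogue `Literature/Barriers/RiemannHypothesis/`, companion of `TuranPartialSums.lean`
(sixth layer of the "vertical shift" proof of `TuranPartialSums` for large `N`). Everything is
PROVED. `TuranPartialSumsShiftMain.lean` bounds `‖B(N)‖` from above and `R(N)` from below by
explicit integrals over `u ∈ [u_M, 1]` of step functions of the block values `S(N/⌈N^u⌉)`,
`S(N/⌊N^u⌋)`; this file supplies what a verified interval-arithmetic checker needs to enclose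
them cell by cell in `w = 1/log N` and `u`:

* **block values in `τ`-scaled form** (`τ = X w`): for `u ∈ [½, 1]` and `t = N^u`, `q = N^{1−u}`,
  the index `m = N/⌈t⌉` (or `N/⌊t⌋`) satisfies `1 ≤ m`, `m ≤ q t/(t−1)`, `q t/(t+1) < m + 1`
  (`blockIndexC_bounds`, `blockIndexF_bounds`), and
  `‖τ S(m) − ((1 − e^{−iX(1−u)})(−i) + τ c₀)‖ ≤ τ (1/m + 1/(t−1) + 1/(2m) + ‖s(s+1)‖/(16m²))`
  (`norm_tau_powSum_ceil_sub_le`, `norm_tau_powSum_floor_sub_le`); the exact form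
  `τ S(m) = ∑_{k≤m} τ e^{−iτ log k}/k` (`tau_mul_powSum_eq_sum`) for the finitely many small `m`;
  the constant: `‖τ c₀ − (τ S(30) − (1 − 30^{−iτ})(−i) − τ 30^{−iτ}/60)‖ ≤ τ‖s(s+1)‖/14400`
  (`norm_tau_emConst_sub_le`);
* **the envelope ratio** `thetaEnv(t)/t`: antitone pieces `tableEnv(t)/t` (`t ≥ e⁴`) and
  `sylvEnv(t)/t` (`t ≥ 1`), the junction constant `sylvEnv(Z)/Z ≤ 0.0864`, and the values at
  `t = e^{v}` (`tableEnv_exp_div`, `sylvEnv_exp_div`, `thetaEnv_div_le_max`, `thetaEnv_div_le_sylv`);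
* **quadrature by range enclosure**: bounds for `∫_a^b f` from pointwise bounds on `[a, b]`
  (`re_integral_bounds`, `im_integral_bounds`, `integral_bounds_real`) and integrability of the
  four `u`-integrands on subintervals of `(0, 1]`.

The scalar terms of `norm_Bval_le` / `Rval_ge` are put in checker-ready form in the next layer.

## References

* Only the tree's own layers `TuranPartialSumsShift{EM,Abel,Theta,Blocks,Main}.lean`. [folklore]
-/

noncomputable section

open Real Complex Set MeasureTheory intervalIntegral Finset Filter Topology

namespace Literature.Barriers.RiemannHypothesis

namespace TuranShift

/-! ## Block indices along `t = N^u` -/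

section Blocks

variable {N : ℕ} (hN : 360000 ≤ N)
include hN

/-- `N^u · N^{1−u} = N`: `exp(uL) · exp((1−u)L) = N`, `L = log N`. [folklore] -/
theorem exp_mul_exp_eq (u : ℝ) :
    Real.exp (u * Real.log N) * Real.exp ((1 - u) * Real.log N) = N := by
  rw [← Real.exp_add, show u * Real.log N + (1 - u) * Real.log N = Real.log N by ring,
    Real.exp_log (by exact_mod_cast (by omega : 0 < N))]

/-- `N / N^u = N^{1−u}`. [folklore] -/
theorem div_exp_eq (u : ℝ) : (N : ℝ) / Real.exp (u * Real.log N) = Real.exp ((1 - u) * Real.log N) := by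
  rw [div_eq_iff (Real.exp_pos _).ne', mul_comm]
  exact (exp_mul_exp_eq hN u).symm

/-- `N^u ≤ N` for `u ≤ 1`. [folklore] -/
theorem exp_le_natCast {u : ℝ} (hu : u ≤ 1) : Real.exp (u * Real.log N) ≤ N := by
  have hL := log_pos hN
  calc Real.exp (u * Real.log N) ≤ Real.exp (1 * Real.log N) :=
        Real.exp_le_exp.2 (mul_le_mul_of_nonneg_right hu hL.le)
    _ = N := exp_one_mul_log hN

/-- `N^u ≥ 600` for `u ≥ 1/2` (indeed `≥ √N ≥ 600`). [folklore] -/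
theorem exp_ge {u : ℝ} (hu : 1 / 2 ≤ u) : (600 : ℝ) ≤ Real.exp (u * Real.log N) := by
  have hL := log_pos hN
  have hN0 : (0 : ℝ) < N := by exact_mod_cast (by omega : 0 < N)
  have h1 : Real.exp (1 / 2 * Real.log N) = Real.sqrt N := by
    rw [Real.sqrt_eq_rpow, Real.rpow_def_of_pos hN0]
    ring_nf
  have h2 : (600 : ℝ) ≤ Real.sqrt N := by
    rw [Real.le_sqrt (by norm_num) hN0.le]
    exact_mod_cast (by nlinarith : 600 ^ 2 ≤ N)
  calc (600 : ℝ) ≤ Real.exp (1 / 2 * Real.log N) := by rw [h1]; exact h2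
    _ ≤ Real.exp (u * Real.log N) := Real.exp_le_exp.2 (mul_le_mul_of_nonneg_right hu hL.le)

/-- `1 ≤ N^{1−u}` for `u ≤ 1`. [folklore] -/
theorem one_le_exp_compl {u : ℝ} (hu : u ≤ 1) : (1 : ℝ) ≤ Real.exp ((1 - u) * Real.log N) :=
  Real.one_le_exp (mul_nonneg (by linarith) (log_pos hN).le)

/-- **Index bounds along the ceiling blocks.** For `u ∈ [½, 1]`, `t = N^u`, `q = N^{1−u}` and
`m = N/⌈t⌉`: `1 ≤ m`, `m ≤ q`, and `q · t/(t+1) < m + 1`. [folklore] -/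
theorem blockIndexC_bounds {u : ℝ} (_hu0 : 1 / 2 ≤ u) (hu1 : u ≤ 1) :
    1 ≤ N / ⌈Real.exp (u * Real.log N)⌉₊ ∧
      ((N / ⌈Real.exp (u * Real.log N)⌉₊ : ℕ) : ℝ) ≤ Real.exp ((1 - u) * Real.log N) ∧
      Real.exp ((1 - u) * Real.log N) * (Real.exp (u * Real.log N) / (Real.exp (u * Real.log N) + 1)) <
        (N / ⌈Real.exp (u * Real.log N)⌉₊ : ℕ) + 1 := by
  set t := Real.exp (u * Real.log N) with ht
  have ht0 : 0 < t := Real.exp_pos _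
  obtain ⟨h1, h2⟩ := div_ceil_bounds N ht0
  refine ⟨?_, ?_, ?_⟩
  · refine one_le_div_of_le (Nat.one_le_iff_ne_zero.2 (Nat.ceil_pos.2 ht0).ne') ?_
    exact Nat.ceil_le.2 (exp_le_natCast hN hu1)
  · rwa [div_exp_eq hN u] at h1
  · have : (N : ℝ) / (t + 1) = Real.exp ((1 - u) * Real.log N) * (t / (t + 1)) := by
      rw [← div_exp_eq hN u]
      field_simp
      exact ht.symm
    rwa [this] at h2

/-- **Index bounds along the floor blocks.** For `u ∈ [½, 1]`, `t = N^u`, `q = N^{1−u}` and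
`m = N/⌊t⌋`: `1 ≤ m`, `m (t − 1) ≤ q t` (i.e. `m ≤ q t/(t−1)`), and `q < m + 1`. [folklore] -/
theorem blockIndexF_bounds {u : ℝ} (hu0 : 1 / 2 ≤ u) (hu1 : u ≤ 1) :
    1 ≤ N / ⌊Real.exp (u * Real.log N)⌋₊ ∧
      ((N / ⌊Real.exp (u * Real.log N)⌋₊ : ℕ) : ℝ) * (Real.exp (u * Real.log N) - 1) ≤
        Real.exp ((1 - u) * Real.log N) * Real.exp (u * Real.log N) ∧
      Real.exp ((1 - u) * Real.log N) < (N / ⌊Real.exp (u * Real.log N)⌋₊ : ℕ) + 1 := by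
  set t := Real.exp (u * Real.log N) with ht
  have ht1 : 1 ≤ t := by linarith [exp_ge hN hu0]
  obtain ⟨h1, h2⟩ := div_floor_bounds N ht1
  refine ⟨?_, ?_, ?_⟩
  · refine one_le_div_of_le (Nat.le_floor (by exact_mod_cast ht1)) ?_
    exact Nat.floor_le_of_le (exp_le_natCast hN hu1)
  · rw [mul_comm (Real.exp ((1 - u) * Real.log N)), exp_mul_exp_eq hN u]; exact h1
  · rwa [div_exp_eq hN u] at h2

omit hN in
/-- `log (1 + 1/x) ≤ 1/x` for `x > 0`, in the form `log ((x + 1)/x) ≤ 1/x`. [folklore] -/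
theorem log_succ_div_le {x : ℝ} (hx : 0 < x) : Real.log ((x + 1) / x) ≤ 1 / x := by
  have h := Real.log_le_sub_one_of_pos (show 0 < (x + 1) / x by positivity)
  have : (x + 1) / x - 1 = 1 / x := by field_simp; ring
  linarith

/-- Logarithmic form of the ceiling bounds: `|log q − log m| ≤ 1/m + 1/(t−1)`. [folklore] -/
theorem abs_log_sub_log_ceil_le {u : ℝ} (hu0 : 1 / 2 ≤ u) (hu1 : u ≤ 1) :
    |Real.log (Real.exp ((1 - u) * Real.log N)) -
        Real.log ((N / ⌈Real.exp (u * Real.log N)⌉₊ : ℕ) : ℝ)| ≤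
      1 / ((N / ⌈Real.exp (u * Real.log N)⌉₊ : ℕ) : ℝ) + 1 / (Real.exp (u * Real.log N) - 1) := by
  obtain ⟨hm1, hmq, hqm⟩ := blockIndexC_bounds hN hu0 hu1
  set t := Real.exp (u * Real.log N) with ht
  set q := Real.exp ((1 - u) * Real.log N) with hq
  set m := N / ⌈t⌉₊ with hm
  have hmR : (1 : ℝ) ≤ m := by exact_mod_cast hm1
  have hm0 : (0 : ℝ) < m := by linarith
  have ht600 : (600 : ℝ) ≤ t := exp_ge hN hu0
  have ht0 : (0 : ℝ) < t := by linarith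
  have ht1 : (0 : ℝ) < t - 1 := by linarith
  have hq0 : 0 < q := Real.exp_pos _
  have hlow : Real.log m ≤ Real.log q := Real.log_le_log hm0 hmq
  have hqlt : q < ((m : ℝ) + 1) * ((t + 1) / t) := by
    have h1 : q * (t / (t + 1)) < (m : ℝ) + 1 := hqm
    have h2 : q = q * (t / (t + 1)) * ((t + 1) / t) := by field_simp
    rw [h2]
    exact mul_lt_mul_of_pos_right h1 (by positivity)
  have hupper : Real.log q - Real.log m ≤ 1 / m + 1 / t := by
    have h1 : Real.log q ≤ Real.log (((m : ℝ) + 1) * ((t + 1) / t)) :=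
      Real.log_le_log hq0 hqlt.le
    have h2 : Real.log (((m : ℝ) + 1) * ((t + 1) / t)) - Real.log m =
        Real.log (((m : ℝ) + 1) / m) + Real.log ((t + 1) / t) := by
      rw [Real.log_mul (by positivity) (by positivity), Real.log_div (by positivity) hm0.ne']
      ring
    have h3 := log_succ_div_le hm0
    have h4 := log_succ_div_le ht0
    linarith
  have h5 : 1 / t ≤ 1 / (t - 1) := one_div_le_one_div_of_le ht1 (by linarith)
  rw [abs_of_nonneg (by linarith)]
  linarith

/-- Logarithmic form of the floor bounds: `|log q − log m| ≤ 1/m + 1/(t−1)`. [folklore] -/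
theorem abs_log_sub_log_floor_le {u : ℝ} (hu0 : 1 / 2 ≤ u) (hu1 : u ≤ 1) :
    |Real.log (Real.exp ((1 - u) * Real.log N)) -
        Real.log ((N / ⌊Real.exp (u * Real.log N)⌋₊ : ℕ) : ℝ)| ≤
      1 / ((N / ⌊Real.exp (u * Real.log N)⌋₊ : ℕ) : ℝ) + 1 / (Real.exp (u * Real.log N) - 1) := by
  obtain ⟨hm1, hmq, hqm⟩ := blockIndexF_bounds hN hu0 hu1
  set t := Real.exp (u * Real.log N) with ht
  set q := Real.exp ((1 - u) * Real.log N) with hq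
  set m := N / ⌊t⌋₊ with hm
  have hmR : (1 : ℝ) ≤ m := by exact_mod_cast hm1
  have hm0 : (0 : ℝ) < m := by linarith
  have ht600 : (600 : ℝ) ≤ t := exp_ge hN hu0
  have ht0 : (0 : ℝ) < t := by linarith
  have ht1 : (0 : ℝ) < t - 1 := by linarith
  have hq0 : 0 < q := Real.exp_pos _
  -- `log m − log q ≤ log (t/(t−1)) ≤ 1/(t−1)`
  have hA : Real.log m - Real.log q ≤ 1 / (t - 1) := by
    have h1 : (m : ℝ) ≤ q * (t / (t - 1)) := by
      rw [← mul_div_assoc, le_div_iff₀ ht1]; exact hmq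
    have h2 : Real.log m ≤ Real.log (q * (t / (t - 1))) := Real.log_le_log hm0 h1
    rw [Real.log_mul hq0.ne' (by positivity)] at h2
    have h3 : Real.log (t / (t - 1)) ≤ 1 / (t - 1) := by
      have := log_succ_div_le ht1
      rwa [show t - 1 + 1 = t by ring] at this
    linarith
  -- `log q − log m ≤ log ((m+1)/m) ≤ 1/m`
  have hB : Real.log q - Real.log m ≤ 1 / m := by
    have h1 : Real.log q ≤ Real.log ((m : ℝ) + 1) := Real.log_le_log hq0 hqm.le
    have h2 : Real.log ((m : ℝ) + 1) - Real.log m = Real.log (((m : ℝ) + 1) / m) := by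
      rw [Real.log_div (by positivity) hm0.ne']
    have h3 := log_succ_div_le hm0
    linarith
  have hpos1 : 0 ≤ 1 / (m : ℝ) := by positivity
  have hpos2 : 0 ≤ 1 / (t - 1) := by positivity
  rw [abs_sub_le_iff]
  constructor <;> linarith

end Blocks

/-! ## Block values in `τ`-scaled form -/

section Values

variable {N : ℕ} (hN : 360000 ≤ N)
include hN

/-- `τ ∫_1^q t^{-s} dt = (1 − q^{−iτ})(−i)` with `q^{−iτ} = e^{−iX(1−u)}` at `q = N^{1−u}` (`u ≤ 1`).
[folklore] -/
theorem tau_mul_powInt_exp {u : ℝ} (hu1 : u ≤ 1) :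
    (tauN N : ℂ) * powInt (sN N) (Real.exp ((1 - u) * Real.log N)) =
      (1 - Complex.exp (-((shiftX * (1 - u) : ℝ) : ℂ) * I)) * (-I) := by
  have hτ := tauN_pos hN
  have hτ0 : (tauN N : ℂ) ≠ 0 := Complex.ofReal_ne_zero.2 hτ.ne'
  rw [powInt_eq (sN_ne_one hN) (one_le_exp_compl hN hu1), sN_sub_one, npow, Real.log_exp]
  have e : Complex.exp (-((tauN N : ℂ) * I * (((1 - u) * Real.log N : ℝ) : ℂ))) =
      Complex.exp (-((shiftX * (1 - u) : ℝ) : ℂ) * I) := by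
    congr 1
    rw [← tauN_mul_log hN]
    push_cast
    ring
  rw [e]
  field_simp
  ring_nf
  rw [Complex.I_sq]
  ring

/-- General scaled enclosure: if `|log q − log m| ≤ δ` (`q = N^{1−u}`, `m ≥ 1`) then
`‖τ S(m) − ((1 − e^{−iX(1−u)})(−i) + τ c₀)‖ ≤ τ (δ + 1/(2m) + ‖s(s+1)‖/(16m²))`. [folklore] -/
theorem norm_tau_powSum_sub_le_of_log {u : ℝ} (hu1 : u ≤ 1) {m : ℕ} (hm : 1 ≤ m) {δ : ℝ}
    (hlog : |Real.log (Real.exp ((1 - u) * Real.log N)) - Real.log m| ≤ δ) :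
    ‖(tauN N : ℂ) * powSum (sN N) m -
        ((1 - Complex.exp (-((shiftX * (1 - u) : ℝ) : ℂ) * I)) * (-I) + (tauN N : ℂ) * emConst (sN N))‖ ≤
      tauN N * (δ + 1 / (2 * m) + ‖sN N * (sN N + 1)‖ / (16 * (m : ℝ) ^ 2)) := by
  have hτ := tauN_pos hN
  have h := norm_powSum_sub_powInt_sub_emConst_le (sN_re N) hm (one_le_exp_compl hN hu1)
  rw [← tau_mul_powInt_exp hN hu1, ← mul_add, ← mul_sub, norm_mul, Complex.norm_real,
    Real.norm_eq_abs, abs_of_pos hτ]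
  exact mul_le_mul_of_nonneg_left (h.trans (by linarith)) hτ.le

/-- **Scaled enclosure along the ceiling blocks** (`u ∈ [½, 1]`, `t = N^u`, `m = N/⌈t⌉`):
`‖τ S(m) − ((1 − e^{−iX(1−u)})(−i) + τ c₀)‖ ≤ τ (1/m + 1/(t−1) + 1/(2m) + ‖s(s+1)‖/(16m²))`.
[folklore] -/
theorem norm_tau_powSum_ceil_sub_le {u : ℝ} (hu0 : 1 / 2 ≤ u) (hu1 : u ≤ 1) :
    ‖(tauN N : ℂ) * powSum (sN N) (N / ⌈Real.exp (u * Real.log N)⌉₊) -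
        ((1 - Complex.exp (-((shiftX * (1 - u) : ℝ) : ℂ) * I)) * (-I) + (tauN N : ℂ) * emConst (sN N))‖ ≤
      tauN N * (1 / ((N / ⌈Real.exp (u * Real.log N)⌉₊ : ℕ) : ℝ) + 1 / (Real.exp (u * Real.log N) - 1) +
        1 / (2 * ((N / ⌈Real.exp (u * Real.log N)⌉₊ : ℕ) : ℝ)) +
        ‖sN N * (sN N + 1)‖ / (16 * ((N / ⌈Real.exp (u * Real.log N)⌉₊ : ℕ) : ℝ) ^ 2)) :=
  norm_tau_powSum_sub_le_of_log hN hu1 (blockIndexC_bounds hN hu0 hu1).1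
    (abs_log_sub_log_ceil_le hN hu0 hu1)

/-- **Scaled enclosure along the floor blocks** (`m = N/⌊t⌋`). [folklore] -/
theorem norm_tau_powSum_floor_sub_le {u : ℝ} (hu0 : 1 / 2 ≤ u) (hu1 : u ≤ 1) :
    ‖(tauN N : ℂ) * powSum (sN N) (N / ⌊Real.exp (u * Real.log N)⌋₊) -
        ((1 - Complex.exp (-((shiftX * (1 - u) : ℝ) : ℂ) * I)) * (-I) + (tauN N : ℂ) * emConst (sN N))‖ ≤
      tauN N * (1 / ((N / ⌊Real.exp (u * Real.log N)⌋₊ : ℕ) : ℝ) + 1 / (Real.exp (u * Real.log N) - 1) +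
        1 / (2 * ((N / ⌊Real.exp (u * Real.log N)⌋₊ : ℕ) : ℝ)) +
        ‖sN N * (sN N + 1)‖ / (16 * ((N / ⌊Real.exp (u * Real.log N)⌋₊ : ℕ) : ℝ) ^ 2)) :=
  norm_tau_powSum_sub_le_of_log hN hu1 (blockIndexF_bounds hN hu0 hu1).1
    (abs_log_sub_log_floor_le hN hu0 hu1)

omit hN in
/-- **The exact scaled block value**: `τ S(m) = ∑_{k=1}^{m} τ e^{−iτ log k} k⁻¹` (any real `τ`).
[folklore] -/
theorem tau_mul_powSum_eq_sum (τ : ℝ) (m : ℕ) :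
    (τ : ℂ) * powSum (1 + τ * I) m =
      ∑ k ∈ Finset.Icc 1 m, (τ : ℂ) * Complex.exp (-((τ * Real.log k : ℝ) : ℂ) * I) * (((k : ℝ)⁻¹ : ℝ) : ℂ) := by
  rw [powSum, Finset.mul_sum]
  refine Finset.sum_congr rfl fun k hk ↦ ?_
  have hk0 : (0 : ℝ) < k := by exact_mod_cast (Finset.mem_Icc.1 hk).1
  rw [npow_one_add τ hk0, npow]
  push_cast
  ring_nf

omit hN in
/-- The harmonic bound in scaled form: `‖τ S(m)‖ ≤ τ (1 + log m)` (`τ ≥ 0`). [folklore] -/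
theorem norm_tau_powSum_le {τ : ℝ} (hτ : 0 ≤ τ) (m : ℕ) :
    ‖(τ : ℂ) * powSum (1 + τ * I) m‖ ≤ τ * (1 + Real.log m) := by
  rw [norm_mul, Complex.norm_real, Real.norm_eq_abs, abs_of_nonneg hτ]
  exact mul_le_mul_of_nonneg_left (norm_powSum_le_one_add_log (by simp) m) hτ

/-- **The scaled constant**: with `K = 30`,
`‖τ c₀ − (τ S(30) − (1 − 30^{−iτ})(−i) − τ 30^{−iτ}/60)‖ ≤ τ ‖s(s+1)‖/14400`. [folklore] -/
theorem norm_tau_emConst_sub_le :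
    ‖(tauN N : ℂ) * emConst (sN N) -
        ((tauN N : ℂ) * powSum (sN N) 30 -
          (1 - Complex.exp (-((tauN N * Real.log 30 : ℝ) : ℂ) * I)) * (-I) -
          (tauN N : ℂ) * Complex.exp (-((tauN N * Real.log 30 : ℝ) : ℂ) * I) * (((1 / 60 : ℝ)) : ℂ))‖ ≤
      tauN N * (‖sN N * (sN N + 1)‖ / 14400) := by
  have hτ := tauN_pos hN
  have hτ0 : (tauN N : ℂ) ≠ 0 := Complex.ofReal_ne_zero.2 hτ.ne'
  have h := norm_emConst_sub_le (sN_re N) (K := 30) (by norm_num)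
  have hInt : (tauN N : ℂ) * powInt (sN N) 30 =
      (1 - Complex.exp (-((tauN N * Real.log 30 : ℝ) : ℂ) * I)) * (-I) := by
    rw [powInt_eq (sN_ne_one hN) (by norm_num), sN_sub_one, npow]
    have e : Complex.exp (-((tauN N : ℂ) * I * ((Real.log 30 : ℝ) : ℂ))) =
        Complex.exp (-((tauN N * Real.log 30 : ℝ) : ℂ) * I) := by
      congr 1; push_cast; ring
    push_cast at e ⊢
    rw [e]
    field_simp
    ring_nf
    rw [Complex.I_sq]
    ring
  have hHalf : (tauN N : ℂ) * (npow (sN N) 30 / 2) =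
      (tauN N : ℂ) * Complex.exp (-((tauN N * Real.log 30 : ℝ) : ℂ) * I) * (((1 / 60 : ℝ)) : ℂ) := by
    rw [sN_def, npow_one_add _ (by norm_num : (0 : ℝ) < 30), npow]
    have e : Complex.exp (-((tauN N : ℂ) * I * ((Real.log 30 : ℝ) : ℂ))) =
        Complex.exp (-((tauN N * Real.log 30 : ℝ) : ℂ) * I) := by
      congr 1; push_cast; ring
    rw [e]
    push_cast
    ring
  have key : (tauN N : ℂ) * emConst (sN N) -
      ((tauN N : ℂ) * powSum (sN N) 30 -
        (1 - Complex.exp (-((tauN N * Real.log 30 : ℝ) : ℂ) * I)) * (-I) -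
        (tauN N : ℂ) * Complex.exp (-((tauN N * Real.log 30 : ℝ) : ℂ) * I) * (((1 / 60 : ℝ)) : ℂ)) =
      (tauN N : ℂ) * (emConst (sN N) - (powSum (sN N) 30 - powInt (sN N) 30 - npow (sN N) 30 / 2)) := by
    rw [← hInt, ← hHalf]
    ring
  rw [key, norm_mul, Complex.norm_real, Real.norm_eq_abs, abs_of_pos hτ]
  refine mul_le_mul_of_nonneg_left (h.trans (le_of_eq ?_)) hτ.le
  norm_num

end Values

/-! ## The envelope ratio `thetaEnv(t)/t` -/

/-- `v ↦ v² e^{−v/2}` is antitone on `[4, ∞)`. [folklore] -/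
theorem sq_mul_exp_neg_half_antitone : AntitoneOn (fun v : ℝ ↦ v ^ 2 * Real.exp (-(v / 2))) (Ici 4) := by
  have hderiv : ∀ v : ℝ, HasDerivAt (fun v : ℝ ↦ v ^ 2 * Real.exp (-(v / 2)))
      (2 * v * Real.exp (-(v / 2)) + v ^ 2 * (Real.exp (-(v / 2)) * (-(1 / 2)))) v := by
    intro v
    have h1 : HasDerivAt (fun v : ℝ ↦ v ^ 2) (2 * v) v := by simpa using hasDerivAt_pow 2 v
    have h2 : HasDerivAt (fun v : ℝ ↦ -(v / 2)) (-(1 / 2)) v :=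
      ((hasDerivAt_id v).div_const 2).fun_neg
    exact h1.mul h2.exp
  refine antitoneOn_of_deriv_nonpos (convex_Ici 4) ?_ ?_ ?_
  · exact fun v _ ↦ (hderiv v).continuousAt.continuousWithinAt
  · exact fun v _ ↦ (hderiv v).differentiableAt.differentiableWithinAt
  · intro v hv
    rw [interior_Ici] at hv
    rw [(hderiv v).deriv]
    have hv4 : 4 < v := hv
    have hexp : 0 < Real.exp (-(v / 2)) := Real.exp_pos _
    nlinarith [mul_pos hexp (by linarith : (0 : ℝ) < v)]

/-- `v ↦ (10 + 2v) e^{−v/2}` is antitone on `[0, ∞)`. [folklore] -/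
theorem lin_mul_exp_neg_half_antitone :
    AntitoneOn (fun v : ℝ ↦ (10 + 2 * v) * Real.exp (-(v / 2))) (Ici 0) := by
  have hderiv : ∀ v : ℝ, HasDerivAt (fun v : ℝ ↦ (10 + 2 * v) * Real.exp (-(v / 2)))
      (2 * Real.exp (-(v / 2)) + (10 + 2 * v) * (Real.exp (-(v / 2)) * (-(1 / 2)))) v := by
    intro v
    have h1 : HasDerivAt (fun v : ℝ ↦ 10 + 2 * v) 2 v := by
      simpa using ((hasDerivAt_id v).const_mul 2).const_add 10
    have h2 : HasDerivAt (fun v : ℝ ↦ -(v / 2)) (-(1 / 2)) v :=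
      ((hasDerivAt_id v).div_const 2).fun_neg
    exact h1.mul h2.exp
  refine antitoneOn_of_deriv_nonpos (convex_Ici 0) ?_ ?_ ?_
  · exact fun v _ ↦ (hderiv v).continuousAt.continuousWithinAt
  · exact fun v _ ↦ (hderiv v).differentiableAt.differentiableWithinAt
  · intro v hv
    rw [interior_Ici] at hv
    rw [(hderiv v).deriv]
    have hv0 : 0 < v := hv
    have hexp : 0 < Real.exp (-(v / 2)) := Real.exp_pos _
    nlinarith

/-- `tableEnv (e^v) / e^v = v² e^{−v/2}/(8π)`. [folklore] -/
theorem tableEnv_exp_div (v : ℝ) :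
    tableEnv (Real.exp v) / Real.exp v = v ^ 2 * Real.exp (-(v / 2)) / (8 * Real.pi) := by
  unfold tableEnv
  rw [Real.log_exp, ← Real.exp_half, Real.exp_neg]
  have h : Real.exp v = Real.exp (v / 2) * Real.exp (v / 2) := by rw [← Real.exp_add]; ring_nf
  rw [h]
  have := Real.exp_pos (v / 2)
  field_simp

/-- `sylvEnv (e^v) / e^v = 0.0722 + (10 + 2v) e^{−v/2}`. [folklore] -/
theorem sylvEnv_exp_div (v : ℝ) :
    sylvEnv (Real.exp v) / Real.exp v = 0.0722 + (10 + 2 * v) * Real.exp (-(v / 2)) := by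
  unfold sylvEnv
  rw [Real.log_exp, ← Real.exp_half, Real.exp_neg]
  have h : Real.exp v = Real.exp (v / 2) * Real.exp (v / 2) := by rw [← Real.exp_add]; ring_nf
  rw [h]
  have := Real.exp_pos (v / 2)
  field_simp
  ring

/-- **`tableEnv(t)/t` is antitone from `e⁴` on**: `tableEnv t / t ≤ tableEnv a / a` for
`e⁴ ≤ a ≤ t`. [folklore] -/
theorem tableEnv_div_le {a t : ℝ} (ha : Real.exp 4 ≤ a) (hat : a ≤ t) :
    tableEnv t / t ≤ tableEnv a / a := by
  have ha0 : 0 < a := lt_of_lt_of_le (Real.exp_pos 4) ha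
  have ht0 : 0 < t := lt_of_lt_of_le ha0 hat
  rw [← Real.exp_log ht0, ← Real.exp_log ha0, tableEnv_exp_div, tableEnv_exp_div]
  refine div_le_div_of_nonneg_right ?_ (by positivity)
  have hla : 4 ≤ Real.log a := by
    rw [Real.le_log_iff_exp_le ha0]; exact ha
  have hlt : Real.log a ≤ Real.log t := Real.log_le_log ha0 hat
  exact sq_mul_exp_neg_half_antitone hla (le_trans hla hlt) hlt

/-- **`sylvEnv(t)/t` is antitone from `1` on**: `sylvEnv t / t ≤ sylvEnv a / a` for `1 ≤ a ≤ t`.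
[folklore] -/
theorem sylvEnv_div_le {a t : ℝ} (ha : 1 ≤ a) (hat : a ≤ t) :
    sylvEnv t / t ≤ sylvEnv a / a := by
  have ha0 : 0 < a := by linarith
  have ht0 : 0 < t := lt_of_lt_of_le ha0 hat
  rw [← Real.exp_log ht0, ← Real.exp_log ha0, sylvEnv_exp_div, sylvEnv_exp_div]
  have hla : 0 ≤ Real.log a := Real.log_nonneg ha
  have hlt : Real.log a ≤ Real.log t := Real.log_le_log ha0 hat
  have := lin_mul_exp_neg_half_antitone hla (le_trans hla hlt) hlt
  linarith

/-- `log Z ≤ 16.001` for `Z = 8886113`. [folklore] -/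
theorem log_thetaZ_le' : Real.log thetaZ ≤ 16.001 := by
  rw [Real.log_le_iff_le_exp (by norm_num [thetaZ]), thetaZ]
  have h1 : Real.exp 16.001 = Real.exp 1 ^ 16 * Real.exp 0.001 := by
    rw [← Real.exp_nat_mul, ← Real.exp_add]; norm_num
  rw [h1]
  have h2 := Real.exp_one_gt_d9
  have h3 : (1.001 : ℝ) ≤ Real.exp 0.001 := by
    have := Real.add_one_le_exp (0.001 : ℝ)
    linarith
  calc (8886113 : ℝ) ≤ (2.7182818283 : ℝ) ^ 16 * 1.001 := by norm_num
    _ ≤ Real.exp 1 ^ 16 * Real.exp 0.001 :=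
        mul_le_mul (pow_le_pow_left₀ (by norm_num) h2.le 16) h3 (by norm_num) (by positivity)

/-- `2980.95 ≤ √Z`. [folklore] -/
theorem sqrt_thetaZ_ge : (2980.95 : ℝ) ≤ Real.sqrt thetaZ := by
  rw [Real.le_sqrt (by norm_num) (by norm_num [thetaZ]), thetaZ]
  norm_num

/-- **The junction constant**: `sylvEnv Z / Z ≤ 0.0864`. [folklore] -/
theorem sylvEnv_thetaZ_div_le : sylvEnv thetaZ / thetaZ ≤ 0.0864 := by
  have hZ : (0 : ℝ) < thetaZ := by norm_num [thetaZ]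
  have hs := sqrt_thetaZ_ge
  have hl := log_thetaZ_le'
  have hl0 : 0 ≤ Real.log thetaZ := Real.log_nonneg (by norm_num [thetaZ])
  have hsq : Real.sqrt thetaZ * Real.sqrt thetaZ = thetaZ := Real.mul_self_sqrt hZ.le
  have hs0 : 0 < Real.sqrt thetaZ := by linarith
  rw [div_le_iff₀ hZ]
  unfold sylvEnv
  have h1 : 10 + 2 * Real.log thetaZ ≤ 42.002 := by linarith
  have h2 : (42.002 : ℝ) ≤ 0.0142 * Real.sqrt thetaZ := by linarith
  have h3 : Real.sqrt thetaZ * (10 + 2 * Real.log thetaZ) ≤ Real.sqrt thetaZ * (0.0142 * Real.sqrt thetaZ) :=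
    mul_le_mul_of_nonneg_left (h1.trans h2) hs0.le
  nlinarith [h3, hsq]

/-- For `t > Z`: `thetaEnv t / t ≤ 0.0864`. [folklore] -/
theorem thetaEnv_div_le_of_gt {t : ℝ} (ht : thetaZ < t) : thetaEnv t / t ≤ 0.0864 := by
  unfold thetaEnv
  rw [if_neg (not_le.2 ht)]
  exact (sylvEnv_div_le (by norm_num [thetaZ]) ht.le).trans sylvEnv_thetaZ_div_le

/-- **The checker's default bound**: for `e⁴ ≤ a ≤ t`,
`thetaEnv t / t ≤ max (tableEnv a / a) 0.0864`. [folklore] -/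
theorem thetaEnv_div_le_max {a t : ℝ} (ha : Real.exp 4 ≤ a) (hat : a ≤ t) :
    thetaEnv t / t ≤ max (tableEnv a / a) 0.0864 := by
  by_cases h : t ≤ thetaZ
  · unfold thetaEnv
    rw [if_pos h]
    exact (tableEnv_div_le ha hat).trans (le_max_left _ _)
  · exact (thetaEnv_div_le_of_gt (not_le.1 h)).trans (le_max_right _ _)

/-- **The checker's table-regime bound**: for `e⁴ ≤ a ≤ t ≤ Z`, `thetaEnv t / t ≤ tableEnv a / a`.
[folklore] -/
theorem thetaEnv_div_le_table {a t : ℝ} (ha : Real.exp 4 ≤ a) (hat : a ≤ t) (htZ : t ≤ thetaZ) :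
    thetaEnv t / t ≤ tableEnv a / a := by
  unfold thetaEnv
  rw [if_pos htZ]
  exact tableEnv_div_le ha hat

/-- **The checker's Chebyshev-regime bound**: for `Z < a ≤ t`, `thetaEnv t / t ≤ sylvEnv a / a`.
[folklore] -/
theorem thetaEnv_div_le_sylv {a t : ℝ} (ha : thetaZ < a) (hat : a ≤ t) :
    thetaEnv t / t ≤ sylvEnv a / a := by
  unfold thetaEnv
  rw [if_neg (not_le.2 (lt_of_lt_of_le ha hat))]
  have hZ1 : (1 : ℝ) ≤ thetaZ := by norm_num [thetaZ]
  exact sylvEnv_div_le (by linarith) hat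

/-! ## Quadrature by range enclosure -/

/-- Real and imaginary parts of an interval integral of an integrable `ℂ`-valued function.
[folklore] -/
theorem re_integral_eq {f : ℝ → ℂ} {a b : ℝ} (hf : IntervalIntegrable f volume a b) :
    (∫ u in a..b, f u).re = ∫ u in a..b, (f u).re := by
  have := Complex.reCLM.intervalIntegral_comp_comm hf
  simpa using this.symm

/-- Imaginary part of an interval integral. [folklore] -/
theorem im_integral_eq {f : ℝ → ℂ} {a b : ℝ} (hf : IntervalIntegrable f volume a b) :
    (∫ u in a..b, f u).im = ∫ u in a..b, (f u).im := by
  have := Complex.imCLM.intervalIntegral_comp_comm hf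
  simpa using this.symm

/-- **Bounds for a real integral from pointwise bounds**: if `lo ≤ g ≤ hi` on `[a, b]` (`a ≤ b`,
`g` integrable) then `(b − a) lo ≤ ∫_a^b g ≤ (b − a) hi`. [folklore] -/
theorem integral_bounds_real {g : ℝ → ℝ} {a b lo hi : ℝ} (hab : a ≤ b)
    (hg : IntervalIntegrable g volume a b) (h : ∀ u ∈ Icc a b, lo ≤ g u ∧ g u ≤ hi) :
    (b - a) * lo ≤ ∫ u in a..b, g u ∧ ∫ u in a..b, g u ≤ (b - a) * hi := by
  constructor
  · have := intervalIntegral.integral_mono_on hab intervalIntegrable_const hg fun u hu ↦ (h u hu).1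
    rwa [intervalIntegral.integral_const, smul_eq_mul] at this
  · have := intervalIntegral.integral_mono_on hab hg intervalIntegrable_const fun u hu ↦ (h u hu).2
    rwa [intervalIntegral.integral_const, smul_eq_mul] at this

/-- **Bounds for the real part of a complex integral from pointwise bounds.** [folklore] -/
theorem re_integral_bounds {f : ℝ → ℂ} {a b lo hi : ℝ} (hab : a ≤ b)
    (hf : IntervalIntegrable f volume a b) (h : ∀ u ∈ Icc a b, lo ≤ (f u).re ∧ (f u).re ≤ hi) :
    (b - a) * lo ≤ (∫ u in a..b, f u).re ∧ (∫ u in a..b, f u).re ≤ (b - a) * hi := by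
  rw [re_integral_eq hf]
  have hre : IntervalIntegrable (fun u ↦ (f u).re) volume a b := by
    rw [intervalIntegrable_iff] at hf ⊢; exact hf.re
  exact integral_bounds_real hab hre h

/-- **Bounds for the imaginary part of a complex integral from pointwise bounds.** [folklore] -/
theorem im_integral_bounds {f : ℝ → ℂ} {a b lo hi : ℝ} (hab : a ≤ b)
    (hf : IntervalIntegrable f volume a b) (h : ∀ u ∈ Icc a b, lo ≤ (f u).im ∧ (f u).im ≤ hi) :
    (b - a) * lo ≤ (∫ u in a..b, f u).im ∧ (∫ u in a..b, f u).im ≤ (b - a) * hi := by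
  rw [im_integral_eq hf]
  have him : IntervalIntegrable (fun u ↦ (f u).im) volume a b := by
    rw [intervalIntegrable_iff] at hf ⊢; exact hf.im
  exact integral_bounds_real hab him h

/-- A measurable `ℂ`-valued function bounded on `[a, b]` is interval integrable there.
[folklore] -/
theorem intervalIntegrable_of_norm_le_complex {f : ℝ → ℂ} (hf : Measurable f) {a b C : ℝ}
    (hab : a ≤ b) (hC : ∀ t ∈ Icc a b, ‖f t‖ ≤ C) : IntervalIntegrable f volume a b := by
  rw [intervalIntegrable_iff_integrableOn_Icc_of_le hab]
  refine Integrable.mono' (integrable_const C) hf.aestronglyMeasurable ?_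
  filter_upwards [ae_restrict_mem measurableSet_Icc] with t ht
  exact hC t ht

/-! ## Integrability of the four `u`-integrands -/

section Integrands

variable {N : ℕ} (hN : 360000 ≤ N)
include hN

omit hN in
/-- The `B` main integrand `e^{−iXu}/u · S(N/⌈N^u⌉)` is interval integrable on `[a, b]`, `0 < a ≤ b`.
[folklore] -/
theorem intervalIntegrable_mainB_integrand {a b : ℝ} (ha : 0 < a) (hab : a ≤ b) :
    IntervalIntegrable (fun u : ℝ ↦ Complex.exp (-((shiftX * u : ℝ) : ℂ) * I) / (u : ℂ) *
      stepC (powSum (sN N)) N (Real.exp (u * Real.log N))) volume a b := by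
  have hmeas : Measurable (fun u : ℝ ↦ Complex.exp (-((shiftX * u : ℝ) : ℂ) * I) / (u : ℂ) *
      stepC (powSum (sN N)) N (Real.exp (u * Real.log N))) := by
    refine Measurable.mul (by fun_prop) ?_
    exact (measurable_stepC _ N).comp (by fun_prop)
  refine intervalIntegrable_of_norm_le_complex hmeas hab (C := 1 / a * N) fun u hu ↦ ?_
  have hu0 : 0 < u := lt_of_lt_of_le ha hu.1
  have h1 : ‖Complex.exp (-((shiftX * u : ℝ) : ℂ) * I)‖ = 1 := by
    rw [show -((shiftX * u : ℝ) : ℂ) * I = ((-(shiftX * u) : ℝ) : ℂ) * I by push_cast; ring,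
      Complex.norm_exp_ofReal_mul_I]
  rw [norm_mul, norm_div, h1, Complex.norm_real, Real.norm_eq_abs, abs_of_pos hu0]
  exact mul_le_mul (one_div_le_one_div_of_le ha hu.1) (norm_powSum_div_le (sN_re N) N _)
    (norm_nonneg _) (by positivity)

end Integrands

section MoreIntegrands

variable {N : ℕ} (hN : 360000 ≤ N)
include hN

omit hN in
/-- The `R` main integrand `‖S(N/⌈N^u⌉)‖/u` is interval integrable on `[a, b]`, `0 < a ≤ b`.
[folklore] -/
theorem intervalIntegrable_mainR_integrand {a b : ℝ} (ha : 0 < a) (hab : a ≤ b) :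
    IntervalIntegrable (fun u : ℝ ↦ ‖stepC (powSum (sN N)) N (Real.exp (u * Real.log N))‖ / u)
      volume a b := by
  have hmeas : Measurable (fun u : ℝ ↦ ‖stepC (powSum (sN N)) N (Real.exp (u * Real.log N))‖ / u) :=
    ((measurable_stepC _ N).comp (by fun_prop)).norm.div measurable_id
  refine intervalIntegrable_of_norm_le hmeas hab (C := N * (1 / a)) fun u hu ↦ ?_
  have hu0 : 0 < u := lt_of_lt_of_le ha hu.1
  rw [abs_of_nonneg (by positivity), div_eq_mul_one_div]
  exact mul_le_mul (norm_powSum_div_le (sN_re N) N _) (one_div_le_one_div_of_le ha hu.1)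
    (by positivity) (Nat.cast_nonneg N)

/-- A general form of the variation integrands: for `c ≥ 0`,
`u ↦ thetaEnv(N^u) N^{−u} (c u L + 1)/(u² L) ‖S(N/⌊N^u⌋)‖` is interval integrable on `[a, b]`,
`0 < a ≤ b`. [folklore] -/
theorem intervalIntegrable_err_integrand {c : ℝ} (hc0 : 0 ≤ c) {a b : ℝ} (ha : 0 < a) (hab : a ≤ b) :
    IntervalIntegrable (fun u : ℝ ↦ thetaEnv (Real.exp (u * Real.log N)) * Real.exp (-(u * Real.log N)) *
      ((c * (u * Real.log N) + 1) / (u ^ 2 * Real.log N)) *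
        ‖stepF (powSum (sN N)) N (Real.exp (u * Real.log N))‖) volume a b := by
  have hL := log_pos hN
  have hmeas : Measurable (fun u : ℝ ↦ thetaEnv (Real.exp (u * Real.log N)) * Real.exp (-(u * Real.log N)) *
      ((c * (u * Real.log N) + 1) / (u ^ 2 * Real.log N)) *
        ‖stepF (powSum (sN N)) N (Real.exp (u * Real.log N))‖) := by
    refine ((((measurable_thetaEnv.comp (by fun_prop)).mul (by fun_prop)).mul (by fun_prop)).mul ?_)
    exact ((measurable_stepF _ N).comp (by fun_prop)).norm
  refine intervalIntegrable_of_norm_le hmeas hab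
    (C := thetaEnv (Real.exp (b * Real.log N)) * ((c * (b * Real.log N) + 1) / (a ^ 2 * Real.log N)) * N)
    fun u hu ↦ ?_
  have hu0 : 0 < u := lt_of_lt_of_le ha hu.1
  have hexp1 : 1 ≤ Real.exp (u * Real.log N) := Real.one_le_exp (by positivity)
  have hθ0 : 0 ≤ thetaEnv (Real.exp (u * Real.log N)) := thetaEnv_nonneg hexp1
  have hθ : thetaEnv (Real.exp (u * Real.log N)) ≤ thetaEnv (Real.exp (b * Real.log N)) :=
    thetaEnv_le_thetaEnv hexp1 (Real.exp_le_exp.2 (mul_le_mul_of_nonneg_right hu.2 hL.le))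
  have he0 : 0 ≤ Real.exp (-(u * Real.log N)) := (Real.exp_pos _).le
  have he : Real.exp (-(u * Real.log N)) ≤ 1 := by
    rw [Real.exp_le_one_iff]; nlinarith
  have hq0 : 0 ≤ (c * (u * Real.log N) + 1) / (u ^ 2 * Real.log N) :=
    div_nonneg (by nlinarith [mul_nonneg hc0 (mul_nonneg hu0.le hL.le)]) (by positivity)
  have hq : (c * (u * Real.log N) + 1) / (u ^ 2 * Real.log N) ≤ (c * (b * Real.log N) + 1) / (a ^ 2 * Real.log N) := by
    have hb0 : 0 ≤ b := ha.le.trans hab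
    refine div_le_div₀ (by nlinarith [mul_nonneg hc0 (mul_nonneg hb0 hL.le)]) ?_ (by positivity) ?_
    · nlinarith [mul_nonneg hc0 hL.le, hu.2]
    · exact mul_le_mul_of_nonneg_right (pow_le_pow_left₀ ha.le hu.1 2) hL.le
  have hS := norm_powSum_div_le (sN_re N) N (⌊Real.exp (u * Real.log N)⌋₊)
  have hS0 : 0 ≤ ‖stepF (powSum (sN N)) N (Real.exp (u * Real.log N))‖ := norm_nonneg _
  rw [abs_of_nonneg (mul_nonneg (mul_nonneg (mul_nonneg hθ0 he0) hq0) hS0)]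
  calc thetaEnv (Real.exp (u * Real.log N)) * Real.exp (-(u * Real.log N)) *
        ((c * (u * Real.log N) + 1) / (u ^ 2 * Real.log N)) * ‖stepF (powSum (sN N)) N (Real.exp (u * Real.log N))‖
      ≤ thetaEnv (Real.exp (b * Real.log N)) * 1 *
        ((c * (b * Real.log N) + 1) / (a ^ 2 * Real.log N)) * N := by
        refine mul_le_mul (mul_le_mul (mul_le_mul hθ he he0 (hθ0.trans hθ)) hq hq0 (by
          exact mul_nonneg (hθ0.trans hθ) zero_le_one)) hS hS0 ?_
        exact mul_nonneg (mul_nonneg (hθ0.trans hθ) zero_le_one) (hq0.trans hq)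
    _ = _ := by ring

/-- The `B` variation integrand is interval integrable on `[a, b]`, `0 < a ≤ b`. [folklore] -/
theorem intervalIntegrable_errB_integrand {a b : ℝ} (ha : 0 < a) (hab : a ≤ b) :
    IntervalIntegrable (fun u : ℝ ↦ thetaEnv (Real.exp (u * Real.log N)) * Real.exp (-(u * Real.log N)) *
      ((‖(1 : ℂ) + tauN N * I‖ * (u * Real.log N) + 1) / (u ^ 2 * Real.log N)) *
        ‖stepF (powSum (sN N)) N (Real.exp (u * Real.log N))‖) volume a b :=
  intervalIntegrable_err_integrand hN (norm_nonneg _) ha hab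

/-- The `R` variation integrand is interval integrable on `[a, b]`, `0 < a ≤ b`. [folklore] -/
theorem intervalIntegrable_errR_integrand {a b : ℝ} (ha : 0 < a) (hab : a ≤ b) :
    IntervalIntegrable (fun u : ℝ ↦ thetaEnv (Real.exp (u * Real.log N)) * Real.exp (-(u * Real.log N)) *
      ((u * Real.log N + 1) / (u ^ 2 * Real.log N)) *
        ‖stepF (powSum (sN N)) N (Real.exp (u * Real.log N))‖) volume a b := by
  have h := intervalIntegrable_err_integrand hN zero_le_one ha hab
  simpa only [one_mul] using h

end MoreIntegrands

/-! ## The scalar terms in checker-ready form -/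

section Scalars

variable {N : ℕ} (hN : 360000 ≤ N)
include hN

/-- `12 ≤ log N`. [folklore] -/
theorem twelve_le_log : (12 : ℝ) ≤ Real.log N := by
  rw [Real.le_log_iff_exp_le (by exact_mod_cast (by omega : 0 < N))]
  have h1 : Real.exp 12 = Real.exp 1 ^ 12 := by rw [← Real.exp_nat_mul]; norm_num
  rw [h1]
  have h2 := Real.exp_one_lt_d9
  calc Real.exp 1 ^ 12 ≤ (2.7182818286 : ℝ) ^ 12 :=
        pow_le_pow_left₀ (Real.exp_pos 1).le h2.le 12
    _ ≤ 360000 := by norm_num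
    _ ≤ N := by exact_mod_cast hN

/-- `τ ≤ 0.61`. [folklore] -/
theorem tauN_le : tauN N ≤ 0.61 := by
  unfold tauN shiftX
  rw [div_le_iff₀ (log_pos hN)]
  linarith [twelve_le_log hN]

omit hN in
/-- `‖s‖ ≤ 1 + τ`. [folklore] -/
theorem norm_sN_le (N : ℕ) (hτ : 0 ≤ tauN N) : ‖sN N‖ ≤ 1 + tauN N := by
  unfold sN
  refine (norm_add_le _ _).trans ?_
  rw [norm_one, norm_mul, Complex.norm_real, Complex.norm_I, mul_one, Real.norm_eq_abs, abs_of_nonneg hτ]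

/-- `‖s(s+1)‖ ≤ 8`. [folklore] -/
theorem norm_sN_mul_le : ‖sN N * (sN N + 1)‖ ≤ 8 := by
  have hτ := (tauN_pos hN).le
  have h1 := norm_sN_le N hτ
  have h2 : ‖sN N + 1‖ ≤ 2 + tauN N := by
    refine (norm_add_le _ _).trans ?_
    rw [norm_one]; linarith
  have h3 := tauN_le hN
  rw [norm_mul]
  nlinarith [norm_nonneg (sN N), norm_nonneg (sN N + 1)]

/-- `600 ≤ M`, `log M ≤ L/2`, `L/2 ≤ log (M+1)` for `M = ⌊√N⌋`. [folklore] -/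
theorem sqrt_facts :
    (600 : ℝ) ≤ Nat.sqrt N ∧ Real.log (Nat.sqrt N) ≤ Real.log N / 2 ∧
      Real.log N / 2 ≤ Real.log ((Nat.sqrt N : ℝ) + 1) := by
  set M := Nat.sqrt N with hM
  have hM600 : (600 : ℝ) ≤ M := by exact_mod_cast sqrt_ge hN
  have hM0 : (0 : ℝ) < M := by linarith
  have hN0 : (0 : ℝ) < N := by exact_mod_cast (by omega : 0 < N)
  refine ⟨hM600, ?_, ?_⟩
  · have h1 : (M : ℝ) ^ 2 ≤ N := by exact_mod_cast Nat.sqrt_le' N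
    have h2 : Real.log ((M : ℝ) ^ 2) ≤ Real.log N := Real.log_le_log (by positivity) h1
    rw [Real.log_pow] at h2
    push_cast at h2
    linarith
  · have h1 : (N : ℝ) ≤ ((M : ℝ) + 1) ^ 2 := by
      have := Nat.lt_succ_sqrt' N
      exact_mod_cast this.le
    have h2 : Real.log N ≤ Real.log (((M : ℝ) + 1) ^ 2) := Real.log_le_log hN0 h1
    rw [Real.log_pow] at h2
    push_cast at h2
    linarith

/-- `L/2 − 1/M ≤ log M`, hence `0.499 L ≤ log M`. [folklore] -/
theorem log_sqrt_ge : Real.log N / 2 - 1 / Nat.sqrt N ≤ Real.log (Nat.sqrt N) ∧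
    0.499 * Real.log N ≤ Real.log (Nat.sqrt N) := by
  obtain ⟨hM600, _, h3⟩ := sqrt_facts hN
  set M := Nat.sqrt N with hM
  have hM0 : (0 : ℝ) < M := by linarith
  have h4 : Real.log ((M : ℝ) + 1) - Real.log M ≤ 1 / M := by
    rw [← Real.log_div (by linarith) hM0.ne']
    exact log_succ_div_le hM0
  have hL := twelve_le_log hN
  have h5 : 1 / (M : ℝ) ≤ 1 / 600 := one_div_le_one_div_of_le (by norm_num) hM600
  constructor <;> nlinarith

/-- **`u_M` sits just below `½`**: `½ − 1/(M L) ≤ u_M ≤ ½` and `0.49 ≤ u_M`. [folklore] -/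
theorem uM_bounds : 1 / 2 - 1 / (Nat.sqrt N * Real.log N) ≤ uM N ∧ uM N ≤ 1 / 2 ∧ 0.49 ≤ uM N := by
  obtain ⟨hM600, h2, _⟩ := sqrt_facts hN
  obtain ⟨h1, _⟩ := log_sqrt_ge hN
  have hL := log_pos hN
  have hL12 := twelve_le_log hN
  set M := Nat.sqrt N with hM
  have hM0 : (0 : ℝ) < M := by linarith
  have e1 : uM N = Real.log M / Real.log N := rfl
  refine ⟨?_, ?_, ?_⟩
  · rw [e1, le_div_iff₀ hL]
    have : (1 / 2 - 1 / (M * Real.log N)) * Real.log N = Real.log N / 2 - 1 / M := by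
      field_simp
    rw [this]; exact h1
  · rw [e1, div_le_iff₀ hL]; linarith
  · rw [e1, le_div_iff₀ hL]
    have h5 : 1 / (M : ℝ) ≤ 1 / 600 := one_div_le_one_div_of_le (by norm_num) hM600
    nlinarith

/-- **The sliver `[u_M, ½]` of the `B` main integral**: `‖∫_{u_M}^{½} e^{−iXu}/u · S‖ ≤ 2.22/M`.
[folklore] -/
theorem norm_integral_sliver_le :
    ‖∫ u in (uM N)..(1 / 2), Complex.exp (-((shiftX * u : ℝ) : ℂ) * I) / (u : ℂ) *
        stepC (powSum (sN N)) N (Real.exp (u * Real.log N))‖ ≤ 2.22 / Nat.sqrt N := by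
  obtain ⟨hlo, hhi, h049⟩ := uM_bounds hN
  obtain ⟨hM600, _, _⟩ := sqrt_facts hN
  have hL := log_pos hN
  have hL12 := twelve_le_log hN
  set M := Nat.sqrt N with hM
  have hM0 : (0 : ℝ) < M := by linarith
  have hN1 : (1 : ℝ) ≤ N := by exact_mod_cast (by omega : 1 ≤ N)
  -- pointwise bound `(1 + L)/0.49`
  have hpt : ∀ u ∈ Set.uIoc (uM N) (1 / 2), ‖Complex.exp (-((shiftX * u : ℝ) : ℂ) * I) / (u : ℂ) *
      stepC (powSum (sN N)) N (Real.exp (u * Real.log N))‖ ≤ (1 + Real.log N) / 0.49 := by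
    intro u hu
    rw [uIoc_of_le hhi] at hu
    have hu0 : 0.49 ≤ u := by linarith [hu.1]
    have hupos : 0 < u := by linarith
    have h1 : ‖Complex.exp (-((shiftX * u : ℝ) : ℂ) * I)‖ = 1 := by
      rw [show -((shiftX * u : ℝ) : ℂ) * I = ((-(shiftX * u) : ℝ) : ℂ) * I by push_cast; ring,
        Complex.norm_exp_ofReal_mul_I]
    have hS : ‖stepC (powSum (sN N)) N (Real.exp (u * Real.log N))‖ ≤ 1 + Real.log N := by
      unfold stepC
      refine (norm_powSum_le_one_add_log (sN_re N) _).trans ?_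
      have hm : ((N / ⌈Real.exp (u * Real.log N)⌉₊ : ℕ) : ℝ) ≤ N := by
        exact_mod_cast Nat.div_le_self N _
      rcases Nat.eq_zero_or_pos (N / ⌈Real.exp (u * Real.log N)⌉₊) with h0 | hpos
      · rw [h0]; simp; exact hL.le
      · have := Real.log_le_log (by exact_mod_cast hpos) hm
        linarith
    rw [norm_mul, norm_div, h1, Complex.norm_real, Real.norm_eq_abs, abs_of_pos hupos]
    rw [div_eq_mul_one_div _ (0.49 : ℝ), mul_comm (1 + Real.log N)]
    exact mul_le_mul (one_div_le_one_div_of_le (by norm_num) hu0) hS (norm_nonneg _) (by norm_num)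
  have h2 := intervalIntegral.norm_integral_le_of_norm_le_const hpt
  refine h2.trans ?_
  rw [abs_of_nonneg (by linarith)]
  -- `(1+L)/0.49 · (1/2 − u_M) ≤ (1+L)/0.49 · 1/(M L) ≤ 2.22/M`
  have h3 : (1 : ℝ) / 2 - uM N ≤ 1 / (M * Real.log N) := by linarith
  calc (1 + Real.log N) / 0.49 * (1 / 2 - uM N) ≤ (1 + Real.log N) / 0.49 * (1 / (M * Real.log N)) :=
        mul_le_mul_of_nonneg_left h3 (by positivity)
    _ = (1 / Real.log N + 1) / (0.49 * M) := by field_simp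
    _ ≤ (1 / 12 + 1) / (0.49 * M) := by
        gcongr
    _ ≤ 2.22 / M := by
        rw [div_le_div_iff₀ (by positivity) hM0]
        nlinarith

/-- **`tinyB N ≤ 1/N`.** [folklore] -/
theorem tinyB_le : tinyB N ≤ 1 / N := by
  have hN0 : (0 : ℝ) < N := by exact_mod_cast (by omega : 0 < N)
  have hN1 : (1 : ℝ) ≤ N := by exact_mod_cast (by omega : 1 ≤ N)
  have h1 := norm_sN_mul_le hN
  unfold tinyB
  have h2 : ‖sN N * (sN N + 1)‖ / (16 * (N : ℝ) ^ 2) ≤ 8 / (16 * (N : ℝ) ^ 2) :=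
    div_le_div_of_nonneg_right h1 (by positivity)
  have h3 : 8 / (16 * (N : ℝ) ^ 2) ≤ 1 / (2 * N) := by
    rw [div_le_div_iff₀ (by positivity) (by positivity)]
    nlinarith
  have h4 : 1 / (2 * (N : ℝ)) + 1 / (2 * N) = 1 / N := by field_simp; ring
  linarith

/-- The pieces of `deltaB`, `deltaR` against `ℓ = log M ∈ [0.499 L, L/2]`: for `c ≥ 0`,
`(c ℓ + 1)/(M² ℓ²) ≤ (c L/2 + 1)/(M² (0.499 L)²)` and `(c/ℓ + 1/ℓ²)/M ≤ (c/(0.499L) + 1/(0.499L)²)/M`.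
[folklore] -/
theorem delta_pieces_le {c : ℝ} (hc : 0 ≤ c) :
    (c * Real.log (Nat.sqrt N) + 1) / ((Nat.sqrt N : ℝ) ^ 2 * Real.log (Nat.sqrt N) ^ 2) ≤
        (c * (Real.log N / 2) + 1) / ((Nat.sqrt N : ℝ) ^ 2 * (0.499 * Real.log N) ^ 2) ∧
      (c / Real.log (Nat.sqrt N) + 1 / Real.log (Nat.sqrt N) ^ 2) / Nat.sqrt N ≤
        (c / (0.499 * Real.log N) + 1 / (0.499 * Real.log N) ^ 2) / Nat.sqrt N := by
  obtain ⟨hM600, hlogle, _⟩ := sqrt_facts hN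
  obtain ⟨_, hlogge⟩ := log_sqrt_ge hN
  have hL := log_pos hN
  set M := Nat.sqrt N with hM
  set ℓ := Real.log (M : ℝ) with hℓ
  have hℓ0 : 0 < ℓ := lt_of_lt_of_le (by positivity) hlogge
  have h499 : 0 < 0.499 * Real.log N := by positivity
  constructor
  · refine div_le_div₀ (by positivity) (by nlinarith) (by positivity) ?_
    exact mul_le_mul_of_nonneg_left (pow_le_pow_left₀ h499.le hlogge 2) (by positivity)
  · refine div_le_div_of_nonneg_right ?_ (by positivity)
    exact add_le_add (div_le_div_of_nonneg_left hc h499 hlogge)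
      (div_le_div_of_nonneg_left zero_le_one (by positivity) (pow_le_pow_left₀ h499.le hlogge 2))

/-- **`τ · deltaB` in closed monotone form**: with `c = ‖1 + iτ‖`, `L = log N`, `M = ⌊√N⌋`,
`τ deltaB N ≤ (τ + X/2)/2 · ((c L/2 + 1)/(M² (0.499L)²) + (c/(0.499L) + 1/(0.499L)²)/M)`.
[folklore] -/
theorem tau_mul_deltaB_le :
    tauN N * deltaB N ≤ (tauN N + shiftX / 2) / 2 *
      ((‖(1 : ℂ) + tauN N * I‖ * (Real.log N / 2) + 1) / ((Nat.sqrt N : ℝ) ^ 2 * (0.499 * Real.log N) ^ 2) +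
        (‖(1 : ℂ) + tauN N * I‖ / (0.499 * Real.log N) + 1 / (0.499 * Real.log N) ^ 2) / Nat.sqrt N) := by
  obtain ⟨hM600, hlogle, _⟩ := sqrt_facts hN
  obtain ⟨_, hlogge⟩ := log_sqrt_ge hN
  have hL := log_pos hN
  have hτ := tauN_pos hN
  have hX := tauN_mul_log hN
  set c := ‖(1 : ℂ) + tauN N * I‖ with hc
  have hc0 : 0 ≤ c := norm_nonneg _
  obtain ⟨p1, p2⟩ := delta_pieces_le hN hc0
  set M := Nat.sqrt N with hM
  have hℓ0 : 0 < Real.log (M : ℝ) := lt_of_lt_of_le (by positivity) hlogge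
  have hDB : DB (tauN N) M = (c * Real.log M + 1) / ((M : ℝ) ^ 2 * Real.log M ^ 2) := rfl
  have hfac : tauN N * ((1 + Real.log M) / 2) ≤ (tauN N + shiftX / 2) / 2 := by
    have : tauN N * Real.log M ≤ shiftX / 2 := by
      calc tauN N * Real.log M ≤ tauN N * (Real.log N / 2) := mul_le_mul_of_nonneg_left hlogle hτ.le
        _ = shiftX / 2 := by rw [← hX]; ring
    nlinarith
  have hbr0 : 0 ≤ DB (tauN N) M + (c / Real.log M + 1 / Real.log M ^ 2) / M := by
    rw [hDB]; positivity
  unfold deltaB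
  rw [← hM, ← hc, hDB]
  rw [hDB] at hbr0
  calc tauN N * ((1 + Real.log M) / 2 * ((c * Real.log M + 1) / ((M : ℝ) ^ 2 * Real.log M ^ 2) +
        (c / Real.log M + 1 / Real.log M ^ 2) / M))
      = tauN N * ((1 + Real.log M) / 2) * ((c * Real.log M + 1) / ((M : ℝ) ^ 2 * Real.log M ^ 2) +
        (c / Real.log M + 1 / Real.log M ^ 2) / M) := by ring
    _ ≤ (tauN N + shiftX / 2) / 2 * ((c * Real.log M + 1) / ((M : ℝ) ^ 2 * Real.log M ^ 2) +
        (c / Real.log M + 1 / Real.log M ^ 2) / M) := mul_le_mul_of_nonneg_right hfac hbr0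
    _ ≤ _ := by
        refine mul_le_mul_of_nonneg_left (add_le_add p1 p2) ?_
        have : 0 < shiftX := by norm_num [shiftX]
        positivity

/-- **`τ · deltaR` in closed monotone form** (`c = 1`). [folklore] -/
theorem tau_mul_deltaR_le :
    tauN N * deltaR N ≤ (tauN N + shiftX / 2) / 2 *
      ((1 * (Real.log N / 2) + 1) / ((Nat.sqrt N : ℝ) ^ 2 * (0.499 * Real.log N) ^ 2) +
        (1 / (0.499 * Real.log N) + 1 / (0.499 * Real.log N) ^ 2) / Nat.sqrt N) := by
  obtain ⟨hM600, hlogle, _⟩ := sqrt_facts hN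
  obtain ⟨_, hlogge⟩ := log_sqrt_ge hN
  have hL := log_pos hN
  have hτ := tauN_pos hN
  have hX := tauN_mul_log hN
  obtain ⟨p1, p2⟩ := delta_pieces_le hN zero_le_one
  set M := Nat.sqrt N with hM
  have hℓ0 : 0 < Real.log (M : ℝ) := lt_of_lt_of_le (by positivity) hlogge
  have hDR : DR M = (Real.log M + 1) / ((M : ℝ) ^ 2 * Real.log M ^ 2) := rfl
  have hfac : tauN N * ((1 + Real.log M) / 2) ≤ (tauN N + shiftX / 2) / 2 := by
    have : tauN N * Real.log M ≤ shiftX / 2 := by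
      calc tauN N * Real.log M ≤ tauN N * (Real.log N / 2) := mul_le_mul_of_nonneg_left hlogle hτ.le
        _ = shiftX / 2 := by rw [← hX]; ring
    nlinarith
  have hbr0 : 0 ≤ (Real.log M + 1) / ((M : ℝ) ^ 2 * Real.log M ^ 2) + (1 / Real.log M + 1 / Real.log M ^ 2) / M := by
    positivity
  unfold deltaR
  rw [← hM, hDR]
  rw [one_mul] at p1
  calc tauN N * ((1 + Real.log M) / 2 * ((Real.log M + 1) / ((M : ℝ) ^ 2 * Real.log M ^ 2) +
        (1 / Real.log M + 1 / Real.log M ^ 2) / M))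
      = tauN N * ((1 + Real.log M) / 2) * ((Real.log M + 1) / ((M : ℝ) ^ 2 * Real.log M ^ 2) +
        (1 / Real.log M + 1 / Real.log M ^ 2) / M) := by ring
    _ ≤ (tauN N + shiftX / 2) / 2 * ((Real.log M + 1) / ((M : ℝ) ^ 2 * Real.log M ^ 2) +
        (1 / Real.log M + 1 / Real.log M ^ 2) / M) := mul_le_mul_of_nonneg_right hfac hbr0
    _ ≤ _ := by
        rw [one_mul]
        refine mul_le_mul_of_nonneg_left (add_le_add (by simpa using p1) p2) ?_
        have : 0 < shiftX := by norm_num [shiftX]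
        positivity

end Scalars

section Scalars2

variable {N : ℕ} (hN : 360000 ≤ N)
include hN

/-- The middle block value in scaled form: `τ ‖S(N/(M+1))‖ ≤ 2 + ‖τ c₀‖ + τ/1000`. [folklore] -/
theorem tau_norm_powSum_mid_le :
    tauN N * ‖powSum (sN N) (N / (Nat.sqrt N + 1))‖ ≤
      2 + ‖(tauN N : ℂ) * emConst (sN N)‖ + tauN N / 1000 := by
  set M := Nat.sqrt N with hM
  set m₁ := N / (M + 1) with hm₁
  have hM600 := sqrt_ge hN
  have hτ := tauN_pos hN
  -- `m₁ ≥ 599`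
  have hm599 : 599 ≤ m₁ := by
    have h1 : M * M ≤ N := Nat.sqrt_le N
    have h2 : (M - 1) * (M + 1) ≤ N := by
      have hM1 : 1 ≤ M := by omega
      have : (M - 1) * (M + 1) ≤ M * M := by zify [hM1]; nlinarith
      exact this.trans h1
    have h3 : M - 1 ≤ N / (M + 1) := (Nat.le_div_iff_mul_le (by omega)).2 h2
    omega
  have hm1 : 1 ≤ m₁ := by omega
  have hmR : (599 : ℝ) ≤ m₁ := by exact_mod_cast hm599
  have hm0 : (0 : ℝ) < m₁ := by linarith
  -- Euler–Maclaurin at `m₁`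
  have hEM := powSum_eq_powInt_add (sN_re N) hm1
  have hInt : (tauN N : ℂ) * powInt (sN N) m₁ =
      (1 - npow (tauN N * I) m₁) * (-I) := by
    rw [powInt_eq (sN_ne_one hN) (by linarith), sN_sub_one]
    have hτ0 : (tauN N : ℂ) ≠ 0 := Complex.ofReal_ne_zero.2 hτ.ne'
    field_simp
    ring_nf
    rw [Complex.I_sq]
    ring
  have hn1 : ‖(tauN N : ℂ) * powInt (sN N) m₁‖ ≤ 2 := by
    rw [hInt, norm_mul, norm_neg, Complex.norm_I, mul_one]
    refine (norm_sub_le _ _).trans ?_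
    rw [norm_one, norm_npow_mul_I _ hm0]
    norm_num
  have hn2 : ‖(tauN N : ℂ) * (npow (sN N) m₁ / 2)‖ = tauN N / (2 * m₁) := by
    rw [norm_mul, norm_div, Complex.norm_real, Real.norm_eq_abs, abs_of_pos hτ,
      norm_npow_of_re_eq_one (sN_re N) hm0]
    simp
    field_simp
  have hn3 : ‖(tauN N : ℂ) * emTail (sN N) m₁‖ ≤ tauN N * (8 / (16 * (m₁ : ℝ) ^ 2)) := by
    rw [norm_mul, Complex.norm_real, Real.norm_eq_abs, abs_of_pos hτ]
    refine mul_le_mul_of_nonneg_left ((norm_emTail_le (sN_re N) hm1).trans ?_) hτ.le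
    exact div_le_div_of_nonneg_right (norm_sN_mul_le hN) (by positivity)
  have hsmall : tauN N / (2 * m₁) + tauN N * (8 / (16 * (m₁ : ℝ) ^ 2)) ≤ tauN N / 1000 := by
    have h1 : tauN N / (2 * m₁) ≤ tauN N / 1198 := by
      refine div_le_div_of_nonneg_left hτ.le (by norm_num) (by linarith)
    have h2 : tauN N * (8 / (16 * (m₁ : ℝ) ^ 2)) ≤ tauN N * (8 / (16 * (599 : ℝ) ^ 2)) := by
      refine mul_le_mul_of_nonneg_left (div_le_div_of_nonneg_left (by norm_num) (by positivity) ?_) hτ.le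
      nlinarith
    nlinarith
  calc tauN N * ‖powSum (sN N) m₁‖ = ‖(tauN N : ℂ) * powSum (sN N) m₁‖ := by
        rw [norm_mul, Complex.norm_real, Real.norm_eq_abs, abs_of_pos hτ]
    _ = ‖(tauN N : ℂ) * powInt (sN N) m₁ + (tauN N : ℂ) * emConst (sN N) +
          (tauN N : ℂ) * (npow (sN N) m₁ / 2) + (tauN N : ℂ) * emTail (sN N) m₁‖ := by
        rw [hEM]; ring_nf
    _ ≤ ‖(tauN N : ℂ) * powInt (sN N) m₁‖ + ‖(tauN N : ℂ) * emConst (sN N)‖ +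
          ‖(tauN N : ℂ) * (npow (sN N) m₁ / 2)‖ + ‖(tauN N : ℂ) * emTail (sN N) m₁‖ := by
        refine (norm_add_le _ _).trans (add_le_add ((norm_add₃_le).trans le_rfl) le_rfl)
    _ ≤ 2 + ‖(tauN N : ℂ) * emConst (sN N)‖ + tauN N / 1000 := by
        rw [hn2]; linarith

/-- **`τ · bdry` in checker form**: given `η_N ≥ thetaEnv(N)/N`, `η_M ≥ thetaEnv(M)/M` and
`d ≥ ‖τ c₀‖`, `τ bdry N ≤ τ η_N/L + η_M (2 + d + τ/1000)(2/L)`. [folklore] -/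
theorem tau_mul_bdry_le {ηN ηM d : ℝ} (hηN : thetaEnv N / N ≤ ηN)
    (hηM : thetaEnv (Nat.sqrt N) / Nat.sqrt N ≤ ηM)
    (hd : ‖(tauN N : ℂ) * emConst (sN N)‖ ≤ d) :
    tauN N * bdry N ≤ tauN N * ηN / Real.log N + ηM * (2 + d + tauN N / 1000) * (2 / Real.log N) := by
  obtain ⟨hM600, _, hlogM1⟩ := sqrt_facts hN
  have hL := log_pos hN
  have hτ := tauN_pos hN
  have hN0 : (0 : ℝ) < N := by exact_mod_cast (by omega : 0 < N)
  set M := Nat.sqrt N with hM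
  have hM0 : (0 : ℝ) < M := by linarith
  have hθN : 0 ≤ thetaEnv (N : ℝ) := thetaEnv_nonneg (by exact_mod_cast (by omega : 1 ≤ N))
  have hθM : 0 ≤ thetaEnv (M : ℝ) := thetaEnv_nonneg (by linarith)
  have hηM0 : 0 ≤ ηM := le_trans (div_nonneg hθM hM0.le) hηM
  have hlog1 : 0 < Real.log ((M : ℝ) + 1) := lt_of_lt_of_le (by positivity) hlogM1
  have hmid := tau_norm_powSum_mid_le hN
  unfold bdry
  rw [← hM, mul_add]
  refine add_le_add ?_ ?_
  · -- `τ thetaEnv N/(N L) = (thetaEnv N/N) τ / L`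
    have : tauN N * (thetaEnv N / (N * Real.log N)) = (thetaEnv N / N) * (tauN N / Real.log N) := by
      field_simp
    rw [this]
    calc thetaEnv N / N * (tauN N / Real.log N) ≤ ηN * (tauN N / Real.log N) :=
          mul_le_mul_of_nonneg_right hηN (by positivity)
      _ = tauN N * ηN / Real.log N := by ring
  · have h1 : thetaEnv M / ((M : ℝ) + 1) ≤ ηM := by
      refine le_trans ?_ hηM
      exact div_le_div_of_nonneg_left hθM hM0 (by linarith)
    have h2 : 1 / Real.log ((M : ℝ) + 1) ≤ 2 / Real.log N := by
      rw [div_le_div_iff₀ hlog1 hL]; linarith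
    have h3 : tauN N * ‖powSum (sN N) (N / (M + 1))‖ ≤ 2 + d + tauN N / 1000 := by linarith
    have hS0 : 0 ≤ tauN N * ‖powSum (sN N) (N / (M + 1))‖ := by positivity
    calc tauN N * (thetaEnv M * ‖powSum (sN N) (N / (M + 1))‖ / ((M + 1) * Real.log (M + 1)))
        = thetaEnv M / ((M : ℝ) + 1) * (tauN N * ‖powSum (sN N) (N / (M + 1))‖) *
            (1 / Real.log ((M : ℝ) + 1)) := by
          field_simp
      _ ≤ ηM * (2 + d + tauN N / 1000) * (2 / Real.log N) :=
          mul_le_mul (mul_le_mul h1 h3 hS0 hηM0) h2 (by positivity)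
            (mul_nonneg hηM0 (hS0.trans h3))

/-- The `J`-terms rewritten: `thetaEnv(N/m)/(N log(N/m)) = (thetaEnv(N/m)/(N/m)) / (m (L − log m))`
(`1 ≤ m`). [folklore] -/
theorem jTerm_eq {m : ℕ} (hm : 1 ≤ m) :
    thetaEnv ((N : ℝ) / m) / (N * Real.log ((N : ℝ) / m)) =
      (thetaEnv ((N : ℝ) / m) / ((N : ℝ) / m)) / (m * (Real.log N - Real.log m)) := by
  have hN0 : (0 : ℝ) < N := by exact_mod_cast (by omega : 0 < N)
  have hm0 : (0 : ℝ) < m := by exact_mod_cast hm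
  rw [Real.log_div hN0.ne' hm0.ne']
  field_simp

omit hN in
/-- `∫_a^b dx/(x (L − log x)) = log((L − log a)/(L − log b))` for `1 ≤ a ≤ b` with `log b < L`.
[folklore] -/
theorem integral_inv_mul_log_compl {L a b : ℝ} (ha : 1 ≤ a) (hab : a ≤ b) (hb : Real.log b < L) :
    ∫ x in a..b, 1 / (x * (L - Real.log x)) = Real.log ((L - Real.log a) / (L - Real.log b)) := by
  have ha0 : 0 < a := by linarith
  have hpos : ∀ x ∈ Icc a b, 0 < L - Real.log x := by
    intro x hx
    have : Real.log x ≤ Real.log b := Real.log_le_log (by linarith [hx.1]) hx.2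
    linarith
  have hderiv : ∀ x ∈ uIcc a b, HasDerivAt (fun x ↦ -Real.log (L - Real.log x))
      (1 / (x * (L - Real.log x))) x := by
    intro x hx
    rw [uIcc_of_le hab] at hx
    have hx0 : 0 < x := by linarith [hx.1]
    have h1 : HasDerivAt (fun x ↦ L - Real.log x) (0 - x⁻¹) x :=
      (hasDerivAt_const x L).sub (Real.hasDerivAt_log hx0.ne')
    have h2 := (Real.hasDerivAt_log (hpos x hx).ne').comp x h1
    have h3 := h2.fun_neg
    have heq : -((L - Real.log x)⁻¹ * (0 - x⁻¹)) = 1 / (x * (L - Real.log x)) := by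
      have hne := (hpos x hx).ne'
      field_simp
      ring
    rw [heq] at h3
    exact h3
  have hcont : ContinuousOn (fun x ↦ 1 / (x * (L - Real.log x))) (uIcc a b) := by
    rw [uIcc_of_le hab]
    refine continuousOn_const.div (continuousOn_id.mul (continuousOn_const.sub
      (Real.continuousOn_log.mono fun x hx ↦ ?_))) fun x hx ↦ ?_
    · exact (show (0 : ℝ) < x by linarith [hx.1]).ne'
    · have := hpos x hx; have : (0 : ℝ) < x := by linarith [hx.1]
      positivity
  rw [integral_eq_sub_of_hasDerivAt hderiv (hcont.intervalIntegrable), Real.log_div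
    (hpos a ⟨le_rfl, hab⟩).ne' (hpos b ⟨hab, le_rfl⟩).ne']
  ring

omit hN in
/-- `x ↦ 1/(x (L − log x))` is antitone on `[a, b]` when `1 ≤ a` and `log b + 1 ≤ L`. [folklore] -/
theorem inv_mul_log_compl_antitone {L a b : ℝ} (ha : 1 ≤ a) (hb : Real.log b + 1 ≤ L) :
    AntitoneOn (fun x : ℝ ↦ 1 / (x * (L - Real.log x))) (Icc a b) := by
  have ha0 : 0 < a := by linarith
  -- `φ(x) = x (L − log x)` is monotone on `[a, b]`
  have hφ : MonotoneOn (fun x : ℝ ↦ x * (L - Real.log x)) (Icc a b) := by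
    have hd : ∀ x, 0 < x → HasDerivAt (fun x : ℝ ↦ x * (L - Real.log x)) (1 * (L - Real.log x) + x * (0 - x⁻¹)) x := by
      intro x hx
      exact (hasDerivAt_id x).mul ((hasDerivAt_const x L).sub (Real.hasDerivAt_log hx.ne'))
    refine monotoneOn_of_deriv_nonneg (convex_Icc a b) ?_ ?_ ?_
    · exact fun x hx ↦ (hd x (by linarith [hx.1])).continuousAt.continuousWithinAt
    · intro x hx
      rw [interior_Icc] at hx
      exact (hd x (by linarith [hx.1])).differentiableAt.differentiableWithinAt
    · intro x hx
      rw [interior_Icc] at hx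
      have hx0 : 0 < x := by linarith [hx.1]
      rw [(hd x hx0).deriv]
      have : Real.log x ≤ Real.log b := Real.log_le_log hx0 hx.2.le
      field_simp
      linarith
  intro x hx y hy hxy
  have hx0 : 0 < x := by linarith [hx.1]
  have hlogx : Real.log x ≤ Real.log b := Real.log_le_log hx0 hx.2
  have hφx : 0 < x * (L - Real.log x) := mul_pos hx0 (by linarith)
  exact one_div_le_one_div_of_le hφx (hφ hx hy hxy)

/-- **The tail of `Jsum`**: for `mJ ≤ M` and `η_sup ≥ thetaEnv(t)/t` on `[√N, N]`,
`∑_{mJ<m≤M} thetaEnv(N/m)/(N log(N/m)) ≤ η_sup · log(2 (1 − log mJ / L))`. [folklore] -/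
theorem sum_Ioc_jTerm_le {mJ : ℕ} (hmJ1 : 1 ≤ mJ) (hmJ : mJ ≤ Nat.sqrt N) {ηsup : ℝ}
    (hsup : ∀ t : ℝ, Real.sqrt N ≤ t → t ≤ N → thetaEnv t / t ≤ ηsup) :
    ∑ m ∈ Finset.Ioc mJ (Nat.sqrt N), thetaEnv ((N : ℝ) / m) / (N * Real.log ((N : ℝ) / m)) ≤
      ηsup * Real.log (2 * (1 - Real.log mJ / Real.log N)) := by
  obtain ⟨hM600, hlogM, _⟩ := sqrt_facts hN
  have hL := log_pos hN
  have hL12 := twelve_le_log hN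
  have hN0 : (0 : ℝ) < N := by exact_mod_cast (by omega : 0 < N)
  set M := Nat.sqrt N with hM
  set L := Real.log N with hLdef
  have hM0 : (0 : ℝ) < M := by linarith
  have hMsqrt : (M : ℝ) ≤ Real.sqrt N := by
    rw [Real.le_sqrt hM0.le hN0.le]; exact_mod_cast Nat.sqrt_le' N
  have hmJR : (1 : ℝ) ≤ mJ := by exact_mod_cast hmJ1
  have hsqrtN : Real.sqrt N ≤ N := by
    have h1 : (N : ℝ) ≤ (N : ℝ) ^ 2 := by nlinarith [show (1 : ℝ) ≤ N by exact_mod_cast (by omega : 1 ≤ N)]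
    calc Real.sqrt N ≤ Real.sqrt ((N : ℝ) ^ 2) := Real.sqrt_le_sqrt h1
      _ = N := Real.sqrt_sq hN0.le
  -- `η_sup ≥ 0` (from `t = N`)
  have hsup0 : 0 ≤ ηsup :=
    le_trans (div_nonneg (thetaEnv_nonneg (by exact_mod_cast (by omega : 1 ≤ N))) hN0.le)
      (hsup N hsqrtN le_rfl)
  -- termwise bound
  have hterm : ∀ m ∈ Finset.Ioc mJ M, thetaEnv ((N : ℝ) / m) / (N * Real.log ((N : ℝ) / m)) ≤
      ηsup * (1 / (m * (L - Real.log m))) := by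
    intro m hm
    have hm' := Finset.mem_Ioc.1 hm
    have hm1 : 1 ≤ m := by omega
    have hmR : (1 : ℝ) ≤ m := by exact_mod_cast hm1
    have hm0 : (0 : ℝ) < m := by linarith
    have hmM : (m : ℝ) ≤ M := by exact_mod_cast hm'.2
    rw [jTerm_eq hN hm1]
    have hlogm : Real.log m ≤ L / 2 := (Real.log_le_log hm0 hmM).trans hlogM
    have hden : 0 < (m : ℝ) * (L - Real.log m) := mul_pos hm0 (by linarith)
    have hqlo : Real.sqrt N ≤ (N : ℝ) / m := by
      calc Real.sqrt N = N / Real.sqrt N := (Real.div_sqrt).symm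
        _ ≤ N / M := div_le_div_of_nonneg_left hN0.le hM0 hMsqrt
        _ ≤ N / m := div_le_div_of_nonneg_left hN0.le hm0 hmM
    have hqhi : (N : ℝ) / m ≤ N := div_le_self hN0.le hmR
    have h := hsup _ hqlo hqhi
    rw [div_eq_mul_one_div _ ((m : ℝ) * (L - Real.log m))]
    exact mul_le_mul_of_nonneg_right h (by positivity)
  refine (Finset.sum_le_sum hterm).trans ?_
  rw [← Finset.mul_sum]
  refine mul_le_mul_of_nonneg_left ?_ hsup0
  -- comparison with the integral
  have hreidx : ∑ m ∈ Finset.Ioc mJ M, (1 : ℝ) / (m * (L - Real.log m)) =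
      ∑ i ∈ Finset.Ico mJ M, (1 : ℝ) / (((i + 1 : ℕ) : ℝ) * (L - Real.log ((i + 1 : ℕ) : ℝ))) := by
    refine Finset.sum_nbij' (fun m ↦ m - 1) (fun i ↦ i + 1) ?_ ?_ ?_ ?_ ?_
    · intro m hm; simp only [Finset.mem_Ioc] at hm; simp only [Finset.mem_Ico]; omega
    · intro i hi; simp only [Finset.mem_Ico] at hi; simp only [Finset.mem_Ioc]; omega
    · intro m hm; simp only [Finset.mem_Ioc] at hm; omega
    · intro i hi; omega
    · intro m hm
      simp only [Finset.mem_Ioc] at hm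
      have : m - 1 + 1 = m := by omega
      rw [this]
  rw [hreidx]
  have hanti : AntitoneOn (fun x : ℝ ↦ 1 / (x * (L - Real.log x))) (Icc (mJ : ℝ) M) :=
    inv_mul_log_compl_antitone hmJR (by linarith)
  have hcmp := AntitoneOn.sum_le_integral_Ico hmJ hanti
  refine hcmp.trans ?_
  rw [integral_inv_mul_log_compl hmJR (by exact_mod_cast hmJ) (by linarith)]
  -- `log ((L − log mJ)/(L − log M)) ≤ log (2 (1 − log mJ / L))`
  have hlogmJ : Real.log mJ ≤ L / 2 :=
    (Real.log_le_log (by linarith) (by exact_mod_cast hmJ)).trans hlogM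
  have hnum : 0 < L - Real.log mJ := by linarith
  have hden : 0 < L - Real.log M := by linarith
  refine Real.log_le_log (div_pos hnum hden) ?_
  calc (L - Real.log mJ) / (L - Real.log M) ≤ (L - Real.log mJ) / (L / 2) :=
        div_le_div_of_nonneg_left hnum.le (by positivity) (by linarith)
    _ = 2 * (1 - Real.log mJ / L) := by field_simp

/-- **`τ · Jsum` in checker form.** For `2 ≤ mJ ≤ 600`, per-term bounds `η m ≥ thetaEnv(N/m)/(N/m)`
(`2 ≤ m ≤ mJ`) and `η_sup ≥ thetaEnv(t)/t` on `[√N, N]`, with `w = 1/L`: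
`τ Jsum N ≤ ∑_{m=2}^{mJ} η m · X w²/((1 − w log m) m) + τ η_sup log(2 (1 − w log mJ))`. [folklore] -/
theorem tau_mul_Jsum_le {mJ : ℕ} (hmJ2 : 2 ≤ mJ) (hmJ600 : mJ ≤ 600) {η : ℕ → ℝ}
    (hη : ∀ m ∈ Finset.Icc 2 mJ, thetaEnv ((N : ℝ) / m) / ((N : ℝ) / m) ≤ η m) {ηsup : ℝ}
    (hsup : ∀ t : ℝ, Real.sqrt N ≤ t → t ≤ N → thetaEnv t / t ≤ ηsup) :
    tauN N * Jsum N ≤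
      ∑ m ∈ Finset.Icc 2 mJ, η m * (shiftX * (1 / Real.log N) ^ 2 /
        ((1 - (1 / Real.log N) * Real.log m) * m)) +
        tauN N * ηsup * Real.log (2 * (1 - (1 / Real.log N) * Real.log mJ)) := by
  obtain ⟨hM600R, hlogM, _⟩ := sqrt_facts hN
  have hM600 := sqrt_ge hN
  have hL := log_pos hN
  have hL12 := twelve_le_log hN
  have hτ := tauN_pos hN
  have hX := tauN_mul_log hN
  have hN0 : (0 : ℝ) < N := by exact_mod_cast (by omega : 0 < N)
  set M := Nat.sqrt N with hM
  set L := Real.log N with hLdef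
  have hmJM : mJ ≤ M := by omega
  -- split the sum
  have hsplit : Jsum N = ∑ m ∈ Finset.Icc 2 mJ, thetaEnv ((N : ℝ) / m) / (N * Real.log ((N : ℝ) / m)) +
      ∑ m ∈ Finset.Ioc mJ M, thetaEnv ((N : ℝ) / m) / (N * Real.log ((N : ℝ) / m)) := by
    unfold Jsum
    rw [← hM, ← Finset.sum_filter_add_sum_filter_not (Finset.Icc 2 M) (fun m ↦ m ≤ mJ)]
    congr 1
    · congr 1; ext m; simp only [Finset.mem_filter, Finset.mem_Icc]; omega
    · congr 1; ext m; simp only [Finset.mem_filter, Finset.mem_Icc, Finset.mem_Ioc]; omega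
  rw [hsplit, mul_add]
  refine add_le_add ?_ ?_
  · rw [Finset.mul_sum]
    refine Finset.sum_le_sum fun m hm ↦ ?_
    have hm' := Finset.mem_Icc.1 hm
    have hm1 : 1 ≤ m := by omega
    have hm0 : (0 : ℝ) < m := by exact_mod_cast (by omega : 0 < m)
    have hlogm : Real.log m ≤ L / 2 :=
      (Real.log_le_log hm0 (by exact_mod_cast (hm'.2.trans hmJM))).trans hlogM
    rw [jTerm_eq hN hm1]
    have hden : 0 < (m : ℝ) * (L - Real.log m) := mul_pos hm0 (by linarith)
    have hw : 0 < 1 - 1 / L * Real.log m := by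
      rw [sub_pos, div_mul_eq_mul_div, one_mul, div_lt_one hL]; linarith
    have hkey : tauN N / ((m : ℝ) * (L - Real.log m)) =
        shiftX * (1 / L) ^ 2 / ((1 - 1 / L * Real.log m) * m) := by
      rw [← hX]; field_simp
    have hθ0 : 0 ≤ thetaEnv ((N : ℝ) / m) / ((N : ℝ) / m) := by
      have : (1 : ℝ) ≤ N / m := by
        rw [le_div_iff₀ hm0]
        have h1 : (m : ℝ) ≤ M := by exact_mod_cast hm'.2.trans hmJM
        have h2 : (M : ℝ) * M ≤ N := by exact_mod_cast Nat.sqrt_le N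
        nlinarith
      exact div_nonneg (thetaEnv_nonneg this) (by positivity)
    calc tauN N * (thetaEnv ((N : ℝ) / m) / ((N : ℝ) / m) / (m * (L - Real.log m)))
        = thetaEnv ((N : ℝ) / m) / ((N : ℝ) / m) * (tauN N / (m * (L - Real.log m))) := by ring
      _ ≤ η m * (tauN N / (m * (L - Real.log m))) :=
          mul_le_mul_of_nonneg_right (hη m hm) (by positivity)
      _ = _ := by rw [hkey]
  · have h := sum_Ioc_jTerm_le hN (by omega) hmJM hsup
    have hsup0 : 0 ≤ ηsup * Real.log (2 * (1 - Real.log mJ / L)) ∨ True := Or.inr trivial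
    calc tauN N * ∑ m ∈ Finset.Ioc mJ M, thetaEnv ((N : ℝ) / m) / (N * Real.log ((N : ℝ) / m))
        ≤ tauN N * (ηsup * Real.log (2 * (1 - Real.log mJ / L))) := mul_le_mul_of_nonneg_left h hτ.le
      _ = _ := by rw [div_eq_mul_one_div (Real.log mJ) L]; ring

/-- **The side condition of the criterion**: for `p ∈ T`, `2 τ ‖S(N/p)‖/p ≤ 2 (τ + X/2)/(M + 1)`.
[folklore] -/
theorem side_bound {p : ℕ} (hp : p ∈ bigPrimes N) :
    2 * (tauN N * (‖powSum (sN N) (N / p)‖ / p)) ≤ 2 * (tauN N + shiftX / 2) / (Nat.sqrt N + 1) := by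
  obtain ⟨⟨hpM, hpN⟩, _⟩ := mem_bigPrimes.1 hp
  obtain ⟨hM600, hlogM, _⟩ := sqrt_facts hN
  have hτ := tauN_pos hN
  have hX := tauN_mul_log hN
  set M := Nat.sqrt N with hM
  have hp1 : (M : ℝ) + 1 ≤ p := by exact_mod_cast hpM
  have hp0 : (0 : ℝ) < p := by linarith
  have h1 := norm_powSum_div_le_log hpM hpN
  have h2 : tauN N * ‖powSum (sN N) (N / p)‖ ≤ tauN N + shiftX / 2 := by
    calc tauN N * ‖powSum (sN N) (N / p)‖ ≤ tauN N * (1 + Real.log M) := mul_le_mul_of_nonneg_left h1 hτ.le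
      _ ≤ tauN N * (1 + Real.log N / 2) := by gcongr
      _ = tauN N + shiftX / 2 := by rw [← hX]; ring
  have hX0 : (0 : ℝ) < shiftX := by norm_num [shiftX]
  have h3 : 0 ≤ tauN N + shiftX / 2 := by positivity
  have h4 : tauN N * ‖powSum (sN N) (N / p)‖ / p ≤ (tauN N + shiftX / 2) / ((M : ℝ) + 1) :=
    div_le_div₀ h3 h2 (by positivity) hp1
  calc 2 * (tauN N * (‖powSum (sN N) (N / p)‖ / p)) = 2 * (tauN N * ‖powSum (sN N) (N / p)‖ / p) := by ring
    _ ≤ 2 * ((tauN N + shiftX / 2) / ((M : ℝ) + 1)) := by linarith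
    _ = _ := by ring

end Scalars2

end TuranShift

end Literature.Barriers.RiemannHypothesis
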